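import Summits.ValiantsHypothesis.ValiantsHypothesis.Theses.RealTau
import Summits.ValiantsHypothesis.ValiantsHypothesis.Theorems.RealTauRealTauRefinedStubFischer

/-!
# Route `RealTau`, support item `PowersImpliesRefined` (stmt-ValiantsHypothesis-17933) — proved

`PowersImpliesRefined`: IF the refined real τ-bound holds in the POWERS normal form (Tavenas 2014,
Conj. 3.24 with signed real coefficients: a nonzero `Σ_{i<k} c_i f_i^{α_i}` with `t`-sparse real
`f_i` and `α_i ≤ m` has `≤ 2^(a(m+1)) (k+t+2)^a` distinct real zeros for one absolute `a`), THEN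
`RealTauRefined` (Conj. 3.23, the route's rank-2 crux).

This is a corollary of the landed Fischer/Ryser step of line `fischer-powers` of the crux
(`Theorems.RealTauRealTauRefined.stub_fischer`, Tavenas 2014 Lemme 3.26 via the tree's
`fischer_ryser`): its antecedent — the bound for signed sums `Σ_{i<K} ε_i h_i^m` of `m`-th powers of
`T`-sparse polynomials with `ε_i = ±1` — is the instance `c_i := ε_i`, `f_i := h_i`, `α_i := m` of
the powers form.  Unconditional; axioms `propext`, `Classical.choice`, `Quot.sound`.
-/

noncomputable section

-- single-conjunct layout: Sub = Summit, duplicated namespace component intended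
set_option linter.dupNamespace false

namespace Summit.ValiantsHypothesis.ValiantsHypothesis.Theorems

open Polynomial
open Summit.ValiantsHypothesis.ValiantsHypothesis.Theses.RealTau

/-- **`PowersImpliesRefined` holds** (route `RealTau`, item stmt-ValiantsHypothesis-17933): the
refined real τ-bound for signed sums of powers of sparse polynomials (Tavenas 2014 Conj. 3.24 with
real coefficients `c_i` and exponents `α_i ≤ m`) implies Tavenas' refined real τ-conjecture
`RealTauRefined` (Conj. 3.23), by the Fischer/Ryser step `stub_fischer` (Lemme 3.26) applied to the
instance `c_i = ±1`, `α_i = m`. [cite: Tavenas2014, Lemme 3.26] -/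
theorem PowersImpliesRefined_proof : PowersImpliesRefined := by
  unfold PowersImpliesRefined
  rintro ⟨a, ha⟩
  refine RealTauRealTauRefined.stub_fischer ⟨a, fun K m T ε h hT hne => ?_⟩
  exact ha K m T (fun i => (((ε i : ℤ) : ℝ))) h (fun _ => m) hT (fun _ => le_rfl) hne

end Summit.ValiantsHypothesis.ValiantsHypothesis.Theorems
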